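import Mathlib
import Literature.NumberTheory.Transcendental.KZRulesAssociator
import Literature.NumberTheory.Transcendental.KontsevichZagierGammaProofs
import Summits.KontsevichZagierPeriods.KontsevichZagierPeriods.Theorems.HyperbolicBlochOffTetraSectorKernelStubChudnovskyRing

/-!
# Stub `stub_equianharmonicRing` — crux `OffTetraSectorKernel`, line `odd-hyperbolic-ladder` (skeleton v8, lead c6)

CONJECTURE 1 HOLDS ON THE EQUIANHARMONIC RING — THE CIRCLE AND THE CM CURVE `j = 0`. Second instance of the
algebraically-independent-generators principle `algIndepRing_kernel` (file `…StubChudnovskyRing`), fed with the tree's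
sorry-free Chudnovsky endgame `algebraicIndependent_pi_of_pow_mem_adjoin` for the EQUIANHARMONIC period pair
(`exists_equianharmonic_periodPair`: `g₂ = 0`, `g₃ = 4`, `ω₁ = 2^{2/3}Γ(⅓)³/(4π)`; `(η₁ω₁)² ∈ ℚπ²`,
`sq_η₁_mul_ω₁_of_g₂_eq_zero`): with `x = B(⅓,⅓) = Γ(⅓)²/Γ(⅔) = √3·Γ(⅓)³/(2π)` one has `ω₁⁶ = x⁶/108 ∈ ℚ(π, x)`, so
`π` and `B(⅓,⅓)` — the value of Euler's Beta representation `β(⅓,⅓) = [(0,1), (t(1−t))^{-2/3}]`, a period of the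
Fermat cubic — are algebraically independent (Chudnovsky 1976: `π` and `Γ(⅓)`).

THEOREM (`stub_equianharmonicRing`): on the subring of the formal period ring generated by the algebraic points, the
arctangent carriers and the `β(⅓,⅓)` carriers, `evalP x = 0 → x = 0`; corollary
`equianharmonicRing_inf_ker_le_relations`. (Whether the circle, the lemniscate AND the equianharmonic period generate a
closed ring — algebraic independence of `π, Γ(¼), Γ(⅓)` — is open.)

References: G. V. Chudnovsky (1984), Ch. 7 §2 Cor. 2.3; M. Waldschmidt (2008), §5.2 Cor. 33; M. Kontsevich, D. Zagier,
*Periods* (2001), §1.2, §4.1.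
-/

noncomputable section

open Set MeasureTheory
open Literature.NumberTheory.Transcendental

namespace Summit.KontsevichZagierPeriods.HyperbolicBloch.OffTetraSectorKernel

/-- `B(⅓,⅓)² = 3Γ(⅓)⁶/(4π²)`: `Γ(⅓)Γ(⅔) = π/sin(π/3) = 2π/√3`. [folklore] -/
theorem equianharmonic_beta_sq :
    ProbabilityTheory.beta (((1 / 3 : ℚ)) : ℝ) (((1 / 3 : ℚ)) : ℝ) ^ 2 =
      3 * Real.Gamma (1 / 3) ^ 6 / (4 * Real.pi ^ 2) := by
  have hg : 0 < Real.Gamma (1 / 3) := Real.Gamma_pos_of_pos (by norm_num)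
  have hrefl : Real.Gamma (1 / 3) * Real.Gamma (2 / 3) = 2 * Real.pi / Real.sqrt 3 := by
    have h := Real.Gamma_mul_Gamma_one_sub (1 / 3 : ℝ)
    rw [show (1 : ℝ) - 1 / 3 = 2 / 3 by norm_num, show Real.pi * (1 / 3) = Real.pi / 3 by ring,
      Real.sin_pi_div_three] at h
    rw [h]
    have hs : Real.sqrt 3 ≠ 0 := by positivity
    field_simp
  have hs3 : Real.sqrt 3 ^ 2 = 3 := Real.sq_sqrt (by norm_num)
  have hs : Real.sqrt 3 ≠ 0 := by positivity
  have h23 : Real.Gamma (2 / 3) = 2 * Real.pi / (Real.sqrt 3 * Real.Gamma (1 / 3)) := by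
    have h' : Real.Gamma (1 / 3) * Real.Gamma (2 / 3) * Real.sqrt 3 = 2 * Real.pi := by
      rw [hrefl]
      field_simp
    rw [eq_div_iff (mul_ne_zero hs hg.ne')]
    linear_combination h'
  have hcast : (((1 / 3 : ℚ)) : ℝ) = 1 / 3 := by push_cast; ring
  rw [hcast, ProbabilityTheory.beta, show (1 : ℝ) / 3 + 1 / 3 = 2 / 3 by norm_num, h23]
  have hp : Real.pi ≠ 0 := Real.pi_ne_zero
  field_simp
  rw [hs3]
  ring

/-- **CHUDNOVSKY (1976), equianharmonic form: `π` and `B(⅓,⅓)` are algebraically independent over `ℚ`.**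
(`ω₁⁶ = B(⅓,⅓)⁶/108` and `(η₁ω₁)² ∈ ℚπ²` lie in `ℚ(π, B(⅓,⅓))`.)
[cite: Chudnovsky1984, Ch. 7 §2 Corollary 2.3 (p. 307)] -/
theorem chudnovsky_pi_beta_third :
    AlgebraicIndependent ℚ ![Real.pi, ProbabilityTheory.beta (((1 / 3 : ℚ)) : ℝ) (((1 / 3 : ℚ)) : ℝ)] := by
  set B : ℝ := ProbabilityTheory.beta (((1 / 3 : ℚ)) : ℝ) (((1 / 3 : ℚ)) : ℝ) with hB
  obtain ⟨L, hg₂, hg₃, hω₁⟩ := exists_equianharmonic_periodPair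
  obtain ⟨q, hq⟩ := sq_η₁_mul_ω₁_of_g₂_eq_zero hg₂
  set K : IntermediateField ℚ ℂ := IntermediateField.adjoin ℚ ({(Real.pi : ℂ), (B : ℂ)} : Set ℂ) with hK
  have hBK : (B : ℂ) ∈ K := IntermediateField.subset_adjoin ℚ _ (by simp)
  have hπK : (Real.pi : ℂ) ∈ K := IntermediateField.subset_adjoin ℚ _ (by simp)
  -- `ω₁⁶ = B⁶/108` as real numbers
  set c : ℝ := (2 : ℝ) ^ (2 / 3 : ℝ) with hc
  have hc3 : c ^ 3 = 4 := by
    rw [hc, ← Real.rpow_natCast, ← Real.rpow_mul (by norm_num)]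
    norm_num
  have hG6 : Real.Gamma (1 / 3) ^ 6 = 4 * Real.pi ^ 2 / 3 * B ^ 2 := by
    rw [hB, equianharmonic_beta_sq]
    have hp : Real.pi ≠ 0 := Real.pi_ne_zero
    field_simp
  have hω6 : (c * Real.Gamma (1 / 3) ^ 3 / (4 * Real.pi)) ^ 6 = B ^ 6 / 108 := by
    have hp : Real.pi ≠ 0 := Real.pi_ne_zero
    have e1 : (c * Real.Gamma (1 / 3) ^ 3 / (4 * Real.pi)) ^ 6 =
        (c ^ 3) ^ 2 * (Real.Gamma (1 / 3) ^ 6) ^ 3 / (4 * Real.pi) ^ 6 := by ring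
    rw [e1, hc3, hG6]
    field_simp
    ring
  have hω : L.ω₁ ^ 6 ∈ K := by
    have e : L.ω₁ ^ 6 = (B : ℂ) ^ 6 / 108 := by
      rw [hω₁, ← Complex.ofReal_pow, hω6]
      push_cast
      ring
    rw [e]
    exact div_mem (pow_mem hBK 6) (by exact_mod_cast (natCast_mem K 108))
  have hηω : (L.η₁ * L.ω₁) ^ 2 ∈ K := by
    rw [hq]
    exact mul_mem (SubfieldClass.ratCast_mem K q) (pow_mem hπK 2)
  have halg₂ : IsAlgebraic ℚ L.g₂ := by
    rw [hg₂]
    exact isAlgebraic_zero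
  have halg₃ : IsAlgebraic ℚ L.g₃ := by
    rw [hg₃]
    exact_mod_cast isAlgebraic_nat (R := ℚ) (A := ℂ) 4
  have hC : AlgebraicIndependent ℚ ![(Real.pi : ℂ), (B : ℂ)] :=
    algebraicIndependent_pi_of_pow_mem_adjoin halg₂ halg₃ (B : ℂ) (a := 6) (b := 2) (by norm_num) (by norm_num)
      hω hηω
  refine AlgebraicIndependent.of_comp (Complex.ofRealAm.restrictScalars ℚ) ?_
  convert hC using 1
  funext i
  fin_cases i <;> rfl

/-- A pinned `β(⅓,⅓)` carrier has the class `betaClass ⅓ ⅓`. [cite: KontsevichZagier2001, §1.1] -/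
theorem equianharmonic_beta_class_eq (H : KZ.IntegralRep 1) (hHd : H.domain = {t | t 0 ∈ Set.Ioo (0:ℝ) 1})
    (hHi : Set.EqOn H.integrand
      (fun t => (t 0) ^ (((1 / 3 : ℚ) : ℝ) - 1) * (1 - t 0) ^ (((1 / 3 : ℚ) : ℝ) - 1)) H.domain) :
    KZ.toFormalPeriod (KZ.of H) = Summit.KontsevichZagierPeriods.GammaHodgeSectorKO.betaClass (1 / 3) (1 / 3) :=
  Summit.KontsevichZagierPeriods.GammaHodgeSectorKO.IsBetaRep.toFormalPeriod_eq (by norm_num) (by norm_num)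
    ⟨hHd, fun x hx => by rw [hHi hx]; rfl⟩

/-- **STUB `stub_equianharmonicRing`: CONJECTURE 1 HOLDS ON THE EQUIANHARMONIC RING.** On the subring of the formal
period ring `P = FormalRep ⧸ relations` generated by the algebraic points `⟦[pt, a]⟧`, the arctangent carriers
`⟦[(0,1), 1/(1+t²)]⟧` (value `π/4`) and Euler's Beta carriers `⟦[(0,1), (t(1−t))^{-2/3}]⟧` (value `B(⅓,⅓)`, a
period of the CM elliptic curve `j = 0`), `evalP x = 0 → x = 0` — by Chudnovsky's algebraic independence of `π`
and `Γ(⅓)` (tree theorem `algebraicIndependent_pi_of_pow_mem_adjoin` for the equianharmonic period pair).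
[cite: Chudnovsky1984, Ch. 7 §2 Corollary 2.3 (p. 307)] [cite: KontsevichZagier2001, §1.2] -/
theorem stub_equianharmonicRing :
    ∀ x ∈ Subring.closure
        ({p : KZ.FormalPeriodRing | ∃ (a : ℝ) (ha : IsAlgebraic ℚ a),
            p = KZ.toFormalPeriod (KZ.of (KZ.IntegralRep.unit.constMul a ha))} ∪
          ({p : KZ.FormalPeriodRing | ∃ A : KZ.IntegralRep 1, A.domain = {t | t 0 ∈ Set.Ioo (0:ℝ) 1} ∧
            Set.EqOn A.integrand (fun t => 1 / (1 + t 0 ^ 2)) A.domain ∧ p = KZ.toFormalPeriod (KZ.of A)} ∪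
          {p : KZ.FormalPeriodRing | ∃ H : KZ.IntegralRep 1, H.domain = {t | t 0 ∈ Set.Ioo (0:ℝ) 1} ∧
            Set.EqOn H.integrand (fun t => (t 0) ^ (((1 / 3 : ℚ) : ℝ) - 1) * (1 - t 0) ^ (((1 / 3 : ℚ) : ℝ) - 1))
              H.domain ∧ p = KZ.toFormalPeriod (KZ.of H)})),
      KZ.evalP x = 0 → x = 0 := by
  obtain ⟨A₀, hA₀d, hA₀i⟩ := lindemann_exists_arc
  have ht0 : KZ.evalP (KZ.toFormalPeriod (KZ.of A₀)) = Real.pi / 4 := lindemann_evalP_arc A₀ hA₀d hA₀i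
  have ht1 : KZ.evalP (Summit.KontsevichZagierPeriods.GammaHodgeSectorKO.betaClass (1 / 3) (1 / 3)) =
      ProbabilityTheory.beta (((1 / 3 : ℚ)) : ℝ) (((1 / 3 : ℚ)) : ℝ) :=
    Summit.KontsevichZagierPeriods.GammaHodgeSectorKO.evalP_betaClass (1 / 3) (1 / 3) (by norm_num) (by norm_num)
  have hind : AlgebraicIndependent ℚ ![Real.pi / 4, ProbabilityTheory.beta (((1 / 3 : ℚ)) : ℝ) (((1 / 3 : ℚ)) : ℝ)] := by
    have h := algebraicIndependent_pair_smul chudnovsky_pi_beta_third (c := 1 / 4) (by norm_num)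
    convert h using 2
    push_cast
    ring
  refine algIndepRing_kernel
    ![KZ.toFormalPeriod (KZ.of A₀), Summit.KontsevichZagierPeriods.GammaHodgeSectorKO.betaClass (1 / 3) (1 / 3)]
    ?_ _ ?_
  · convert hind using 1
    funext i
    fin_cases i
    · exact ht0
    · exact ht1
  · rintro g (⟨A, hAd, hAi, rfl⟩ | ⟨H, hHd, hHi, rfl⟩)
    · exact ⟨0, lindemann_arc_class_eq A A₀ hAd hAi hA₀d hA₀i⟩
    · exact ⟨1, equianharmonic_beta_class_eq H hHd hHi⟩

/-- **THE EQUIANHARMONIC RING IS A CLOSED SECTOR OF THE RESIDUE.** [cite: KontsevichZagier2001, §1.2] -/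
theorem equianharmonicRing_inf_ker_le_relations :
    KZ.eval.ker ⊓ (Subring.closure
        ({p : KZ.FormalPeriodRing | ∃ (a : ℝ) (ha : IsAlgebraic ℚ a),
            p = KZ.toFormalPeriod (KZ.of (KZ.IntegralRep.unit.constMul a ha))} ∪
          ({p : KZ.FormalPeriodRing | ∃ A : KZ.IntegralRep 1, A.domain = {t | t 0 ∈ Set.Ioo (0:ℝ) 1} ∧
            Set.EqOn A.integrand (fun t => 1 / (1 + t 0 ^ 2)) A.domain ∧ p = KZ.toFormalPeriod (KZ.of A)} ∪
          {p : KZ.FormalPeriodRing | ∃ H : KZ.IntegralRep 1, H.domain = {t | t 0 ∈ Set.Ioo (0:ℝ) 1} ∧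
            Set.EqOn H.integrand (fun t => (t 0) ^ (((1 / 3 : ℚ) : ℝ) - 1) * (1 - t 0) ^ (((1 / 3 : ℚ) : ℝ) - 1))
              H.domain ∧ p = KZ.toFormalPeriod (KZ.of H)}))).toAddSubgroup.comap
        KZ.toFormalPeriod.toAddMonoidHom ≤ KZ.relations := by
  rintro c ⟨hc, hS⟩
  have hc0 : KZ.eval c = 0 := hc
  exact KZ.toFormalPeriod_eq_zero_iff.mp
    (stub_equianharmonicRing _ hS (by rw [KZ.evalP_toFormalPeriod, hc0]))

end Summit.KontsevichZagierPeriods.HyperbolicBloch.OffTetraSectorKernel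

end
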